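import Literature.MathematicalPhysics.QuantumFieldTheory.Balaban1983to89.B1Ineq226RegularRegion

/-!
# `Balaban1983to89.B1Ineq226RegularRegionSum` — [Balaban1982Higgs1] Prop. 2.1 (2.26) p. 610–611, THE `δG_k(Ω, Ω₀, A)` CLAUSE, VALUE AND
# DERIVATIVE MEMBERS, FOR BIG-BLOCK REGIONS `Ω ⊆ Ω₀ ⊂ T_ε` AT EVERY (2.23)-REGULAR FIELD, ARBITRARY SOURCE `g`: the summation of
# `B1Ineq226RegularRegion.deltaG_region_reg_decay` over the `K`-blocks («the general formulation is obtained by taking the decomposition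
# f = Σ_{Δ⊂Ω} Δf and summing the inequalities», [Balaban1983RegularityDecay] p. 575)

statement-level skeleton of published theorems with citation tags; proofs where landed; nothing here is a claim about the Yang–Mills mass gap

PDF held: `paper:balaban1982-cmp85-higgs23-i` pp. 610–611 [PDF 8–9]; `paper:balaban1983-cmp89-regularity-decay` pp. 573–575, 579 [PDF 3–5, 9].

CITATION HEADER (lean-in-tree rule).  T. Bałaban, *(Higgs)₂,₃ quantum fields in a finite volume. I. A lower bound*, Commun. Math. Phys. **85**
(1982) 603–626 [Balaban1982Higgs1] (Prop. 2.1 (2.26) pp. 610–611) and T. Bałaban, *Regularity and decay of lattice Green's functions*, Commun. Math.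
Phys. **89** (1983) 571–597 [Balaban1983RegularityDecay] (Theorem p. 573 (1.11)–(1.12); §2 ¶1 pp. 574–575; proof p. 579).  Cell `lit-balaban` (HOME
`run/shared/lean/pub/lit-balaban/`), Phase-2 proof seat **p35** gen 13 (unit `lit-balaban-p35`); SKELETON rows **B1.Prop2.1** / **B1.Eq2.26** (REGIONS of
`T_ε`, concrete carrier) and **B4.Thm@573** ((1.11)–(1.12), carrier model instance).  USED BY NAME, never restated: this lineage's
`B1Ineq226RegularRegion.deltaG_region_reg_decay`, `B1Ineq225RegularRegion.{blockPiece, sum_blockPiece, blockPiece_supported, norm_blockPiece_apply_le}`,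
`B1Ineq225DerivRegularRegion.{covDeriv_sum', covDeriv_zero'}`, r14's `tdist_blockIter_le_real`, `sum_exp_neg_tdist_le`, r01's `latticeConst`.

WHAT IS PRINTED.  [B4] pp. 574–575: *«Let us notice only that it is sufficient to prove the Proposition for a function f with support in a unit
cube Δ₀ = B^k(y₀), y₀ ∈ Ω^{(k)}; the general formulation is obtained by taking the decomposition f = Σ_{Δ⊂Ω} Δf and summing the inequalities.»*
[B1] p. 610–611: *«If Ω ⊂ Ω₀, then for δG_k(Ω, Ω₀, A) defined by the equality δG_k(Ω, Ω₀, A) = G_k(Ω, A) − G_k(Ω₀, A), (2.26) we have the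
inequalities (2.24), (2.25) with the additional factor exp(−δ₀ dist(supp f, Ω^c) − δ₀ dist({x, x′}, Ω^c)) on the right sides.»*

WHAT THIS FILE PROVES (kernel-checked, zero `sorry`; theorems only, no definition, no `Prop` fact).
* **`deltaG_region_reg_decay_sum`** — with the data of `B1Ineq226RegularRegion.deltaG_region_reg_decay` (big-block unions `Ω ⊆ Ω₀ ⊂ T_ε`, (2.23) on
  `Ω₀`, `0 < e_K ≤ e₁(K₀)`, `{|y − x| ≤ 2rS + 2M(d+1) + 1} ⊂ Ω`), for EVERY `g` with `‖g‖_∞ ≤ M′` vanishing within `D` of `x`, `x` at distance `≥ D₀`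
  and `supp g` at distance `≥ D₁` from `Ω^c`:  `‖(G^ε_K(Ω, A)1_Ωg − G^ε_K(Ω₀, A)1_{Ω₀}g)(x)‖ ≤ c₀(K₀)(L^Kε)²·exp(−(D + D₀ + D₁)/(8K₀L^K))·M′` and
  `‖(D^ε_A(…))(⟨x, μ⟩)‖ ≤ c₀(K₀)(L^Kε)·exp(−(D + D₀ + D₁)/(8K₀L^K))·M′`.  Proof: `g = Σ_b g|_{B^K(b)}`, each piece within the previous theorem with
  `D_b = max(D, L^K(|x_K − b| − 1))`, and `Σ_b e^{−|x_K − b|/(8K₀)} ≤ K_d(1/(8K₀))` uniformly on `T^{(K)}`.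
HONEST SCOPE.  As `B1Ineq226RegularRegion` (value and derivative members only; rate `1/(8K₀)` per `L^Kε` after the block summation; constants
`c₀(K₀)` not optimised).  Unit `lit-balaban-p35` gen 13 (literature-prover-lit-balaban-p35-g13-0).
-/

open scoped BigOperators

noncomputable section

namespace Literature.MathematicalPhysics.QuantumFieldTheory.Balaban1983to89.B1Ineq226RegularRegionSum

open Literature.MathematicalPhysics.QuantumFieldTheory.Balaban1983to89.HiggsLattice
open Literature.MathematicalPhysics.QuantumFieldTheory.Balaban1983to89.HiggsAveraging
open Literature.MathematicalPhysics.QuantumFieldTheory.Balaban1983to89.HiggsCovariance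
open Literature.MathematicalPhysics.QuantumFieldTheory.Balaban1983to89.B1TorusCubeCover
open Literature.MathematicalPhysics.QuantumFieldTheory.Balaban1983to89.B1TorusCubeLocality26 (rS)
open Literature.MathematicalPhysics.QuantumFieldTheory.Balaban1983to89.B1TorusRegionHSizes (IsBigBlockUnion)
open Literature.MathematicalPhysics.QuantumFieldTheory.Balaban1983to89.B1TorusRegionRop (chi)
open Literature.MathematicalPhysics.QuantumFieldTheory.Balaban1983to89.B1Ineq225RegularRegion (blockPiece sum_blockPiece blockPiece_supported
  norm_blockPiece_apply_le)
open Literature.MathematicalPhysics.QuantumFieldTheory.Balaban1983to89.B1Ineq225DerivRegularRegion (covDeriv_sum' covDeriv_zero')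
open Literature.MathematicalPhysics.QuantumFieldTheory.Balaban1983to89.B1Ineq226RegularRegion (deltaG_region_reg_decay)
open Literature.MathematicalPhysics.QuantumFieldTheory.Balaban1983to89.B1Ineq234Concrete (tdist_blockIter_le_real)
open Literature.MathematicalPhysics.QuantumFieldTheory.Balaban1983to89.B2Eq230CondShiftBound (sum_exp_neg_tdist_le)
open Literature.MathematicalPhysics.QuantumFieldTheory.Balaban1983to89.B4Sect5Proof (latticeConst latticeConst_nonneg)

variable {N : ℕ}

set_option maxHeartbeats 1600000 in
/-- **PROP. 2.1 (2.26) WITH (2.25), VALUE AND DERIVATIVE MEMBERS, FOR BIG-BLOCK REGIONS `Ω ⊆ Ω₀` AT EVERY (2.23)-REGULAR FIELD, ARBITRARY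
`g`** — B4's THEOREM (1.11)–(1.12) WITH (1.10) FOR REGIONS ON THE CARRIER in the operator form of gens 10–12: with the data of
`B1Ineq226RegularRegion.deltaG_region_reg_decay`, constants `K₀min` and, for every `K₀ ≥ K₀min`, `c₀(K₀), e₁(K₀) > 0` such that … for EVERY `g`
with `‖g‖_∞ ≤ M′` vanishing at the sites within distance `< D` of `x`, `x` at distance `≥ D₀` and `supp g` at distance `≥ D₁` from `Ω^c`:
`‖(G^ε_K(Ω, A)1_Ωg − G^ε_K(Ω₀, A)1_{Ω₀}g)(x)‖ ≤ c₀(L^Kε)²·exp(−(D + D₀ + D₁)/(8K₀L^K))·M′` and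
`‖(D^ε_A(G^ε_K(Ω, A)1_Ωg − G^ε_K(Ω₀, A)1_{Ω₀}g))(⟨x, μ⟩)‖ ≤ c₀(L^Kε)·exp(−(D + D₀ + D₁)/(8K₀L^K))·M′`.
Proof: `g = Σ_b g|_{B^K(b)}` over the sites `b` of `T^{(K)}`; each piece is within the previous theorem with `D_b = max(D, L^K(|x_K − b| − 1))`
(r14's `tdist_blockIter_le_real`), `e^{−(D_b + D₀ + D₁)/(4K₀L^K)} ≤ e^{−(D + D₀ + D₁)/(8K₀L^K)}e^{1/(8K₀)}e^{−|x_K − b|/(8K₀)}`, and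
`Σ_b e^{−|x_K − b|/(8K₀)} ≤ K_d(1/(8K₀))` uniformly on `T^{(K)}`.
[cite: Balaban1982Higgs1, Prop. 2.1 (2.26) pp.610–611] [cite: Balaban1983RegularityDecay, Theorem (1.11)–(1.12) p.573; §2 ¶1 pp.574–575; p.579] -/
theorem deltaG_region_reg_decay_sum (d L : ℕ) (hd : 1 ≤ d) (hL : 2 ≤ L) {a : ℝ} (ha : 0 < a) {msq : ℝ} (hmsq : 0 < msq)
    (N : ℕ) (C : ChargeData N) (ε₀ : ℝ) (creg β : ℝ) (hcreg : 0 ≤ creg) (hβ : 0 < β) :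
    ∃ K₀min : ℕ, ∀ K₀ : ℕ, K₀min ≤ K₀ → ∃ c₀ e₁ : ℝ, 0 < c₀ ∧ 0 < e₁ ∧
      ∀ (P : HiggsLattice.Params), P.d = d → P.L = L → K₀ ∣ P.M →
      ∀ {K : ℕ}, 1 ≤ K → K ≤ P.K → (∀ μ, 3 * half P K K₀ ≤ P.sitesPerDir 0 μ) → P.mesh K ≤ ε₀ →
      ∀ (Ω Ω₀ : Finset (HiggsLattice.Site P 0)), IsBigBlockUnion K K₀ Ω → IsBigBlockUnion K K₀ Ω₀ → Ω ⊆ Ω₀ →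
      ∀ (A : HiggsLattice.VecField P 0) {ec : ℝ}, 0 < ec → ec ≤ e₁ →
      (∀ z ∈ Ω₀, ∀ μ ν : Fin P.d,
          P.mesh K * |C.e| / ec * |A ⟨z.shift μ, ν⟩ - A ⟨z, ν⟩| ≤ creg * ec ^ (β - 1) / (P.L : ℝ) ^ K) →
      ∀ (x : HiggsLattice.Site P 0),
        (∀ y, HiggsLattice.Site.tdist x y ≤ 2 * rS P K K₀ + 2 * half P K K₀ * (P.d + 1) + 1 → y ∈ Ω) →
        ∀ (g : HiggsLattice.ScalarField P 0 N) (M D D₀ D₁ : ℝ), (∀ y, ‖g y‖ ≤ M) → 0 ≤ D → 0 ≤ D₀ → 0 ≤ D₁ →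
          (∀ z, g z ≠ 0 → D ≤ (HiggsLattice.Site.tdist x z : ℝ)) →
          (∀ z, z ∉ Ω → D₀ ≤ (HiggsLattice.Site.tdist x z : ℝ)) →
          (∀ y z, g y ≠ 0 → z ∉ Ω → D₁ ≤ (HiggsLattice.Site.tdist z y : ℝ)) →
            ‖(propagatorK C Ω A msq a K (chi Ω • g) - propagatorK C Ω₀ A msq a K (chi Ω₀ • g)) x‖
                ≤ c₀ * P.mesh K ^ 2 * Real.exp (-((D + D₀ + D₁) / (8 * K₀ * (P.L : ℝ) ^ K))) * M ∧
            ∀ μ : Fin P.d,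
              ‖covDeriv C A (propagatorK C Ω A msq a K (chi Ω • g) - propagatorK C Ω₀ A msq a K (chi Ω₀ • g)) ⟨x, μ⟩‖
                ≤ c₀ * P.mesh K * Real.exp (-((D + D₀ + D₁) / (8 * K₀ * (P.L : ℝ) ^ K))) * M := by
  obtain ⟨c₀, hc₀, K₀min, hmain⟩ := deltaG_region_reg_decay d L hd hL ha hmsq N C ε₀ creg β hcreg hβ
  refine ⟨max K₀min 1, fun K₀ hK₀ => ?_⟩
  have hK₀1 : 1 ≤ K₀ := le_trans (le_max_right _ _) hK₀
  have hK₀r : (0 : ℝ) < K₀ := by exact_mod_cast hK₀1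
  obtain ⟨e₁, he₁, hblk⟩ := hmain K₀ (le_trans (le_max_left _ _) hK₀)
  have hrate : (0 : ℝ) < 1 / (8 * K₀) := by positivity
  have hlc : 0 < latticeConst d (1 / (8 * K₀)) := by
    unfold latticeConst
    apply pow_pos
    have hdr : (0 : ℝ) < d := by exact_mod_cast hd
    have h1 : Real.exp (-(1 / (8 * (K₀ : ℝ)) / d)) < 1 := Real.exp_lt_one_iff.2 (by
      have := div_pos hrate hdr; linarith)
    have h2 : 0 < 1 - Real.exp (-(1 / (8 * (K₀ : ℝ)) / d)) := by linarith
    positivity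
  refine ⟨c₀ * Real.exp (1 / (8 * K₀)) * latticeConst d (1 / (8 * K₀)), e₁, by positivity, he₁, ?_⟩
  intro P hPd hPL hK₀M K hK1 hK hN3 hε Ω Ω₀ hΩ hΩ₀ hsub A ec hec hle hreg x hR g M D D₀ D₁ hgM hD0 hD₀0 hD₁0 hD hxD₀ hgD₁
  subst hPd
  have hmK0 : 0 < P.mesh K := P.mesh_pos K
  have hM0 : 0 ≤ M := (norm_nonneg _).trans (hgM x)
  have hLK : (0 : ℝ) < (P.L : ℝ) ^ K := pow_pos (by exact_mod_cast P.hL) K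
  -- the weight of the block `b`
  set wt : HiggsLattice.Site P K → ℝ := fun b =>
    Real.exp (-((D + D₀ + D₁) / (8 * K₀ * (P.L : ℝ) ^ K))) * Real.exp (1 / (8 * K₀))
      * Real.exp (-(1 / (8 * K₀) * (HiggsLattice.Site.tdist (blockIter K x) b : ℝ))) with hwt
  -- each block piece: the previous theorem with `D_b = max D (L^K(|x_K − b| − 1))`
  have hpiece : ∀ b : HiggsLattice.Site P K,
      ‖(propagatorK C Ω A msq a K (chi Ω • blockPiece K b g) - propagatorK C Ω₀ A msq a K (chi Ω₀ • blockPiece K b g)) x‖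
          ≤ c₀ * P.mesh K ^ 2 * wt b * M ∧
      ∀ μ : Fin P.d, ‖covDeriv C A (propagatorK C Ω A msq a K (chi Ω • blockPiece K b g)
          - propagatorK C Ω₀ A msq a K (chi Ω₀ • blockPiece K b g)) ⟨x, μ⟩‖ ≤ c₀ * P.mesh K * wt b * M := by
    intro b
    classical
    by_cases hb : ∃ y₀, blockIter K y₀ = b
    · obtain ⟨y₀, hy₀⟩ := hb
      set Db : ℝ := max D ((P.L : ℝ) ^ K * ((HiggsLattice.Site.tdist (blockIter K x) b : ℝ) - 1)) with hDb
      have hDb0 : 0 ≤ Db := hD0.trans (le_max_left _ _)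
      have hfar : ∀ z, blockPiece K b g z ≠ 0 → Db ≤ (HiggsLattice.Site.tdist x z : ℝ) := by
        intro z hz
        have hzb : blockIter K z = b := by
          by_contra h
          exact hz (by unfold blockPiece; rw [if_neg h])
        have hgz : g z ≠ 0 := fun h0 => hz (by unfold blockPiece; rw [if_pos hzb, h0])
        refine max_le (hD z hgz) ?_
        have h1 := tdist_blockIter_le_real hK x z
        rw [hzb] at h1
        rw [mul_sub, mul_one, sub_le_iff_le_add]
        have h2 : (P.L : ℝ) ^ K * (HiggsLattice.Site.tdist (blockIter K x) b : ℝ)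
            ≤ (P.L : ℝ) ^ K * ((HiggsLattice.Site.tdist x z : ℝ) / (P.L : ℝ) ^ K + 1 - ((P.L : ℝ) ^ K)⁻¹) :=
          mul_le_mul_of_nonneg_left h1 hLK.le
        have e : (P.L : ℝ) ^ K * ((HiggsLattice.Site.tdist x z : ℝ) / (P.L : ℝ) ^ K + 1 - ((P.L : ℝ) ^ K)⁻¹)
            = (HiggsLattice.Site.tdist x z : ℝ) + (P.L : ℝ) ^ K - 1 := by field_simp
        rw [e] at h2
        linarith
      have hgD₁' : ∀ y z, blockPiece K b g y ≠ 0 → z ∉ Ω → D₁ ≤ (HiggsLattice.Site.tdist z y : ℝ) := by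
        intro y z hy hz
        have hyb : blockIter K y = b := by
          by_contra h
          exact hy (by unfold blockPiece; rw [if_neg h])
        have hgy : g y ≠ 0 := fun h0 => hy (by unfold blockPiece; rw [if_pos hyb, h0])
        exact hgD₁ y z hgy hz
      have h := hblk P rfl hPL hK₀M hK1 hK hN3 hε Ω Ω₀ hΩ hΩ₀ hsub A hec hle hreg x hR y₀ (blockPiece K b g) M Db D₀ D₁
        (blockPiece_supported b g hy₀) (fun y => (norm_blockPiece_apply_le b g y).trans (hgM y)) hDb0 hD₀0 hD₁0 hfar hxD₀ hgD₁'
      -- `e^{−(D_b + D₀ + D₁)/(4K₀L^K)} ≤ e^{−(D + D₀ + D₁)/(8K₀L^K)}·e^{1/(8K₀)}·e^{−|x_K − b|/(8K₀)}`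
      have hkey : Real.exp (-((Db + D₀ + D₁) / (4 * K₀ * (P.L : ℝ) ^ K))) ≤ wt b := by
        rw [hwt]
        dsimp only
        rw [← Real.exp_add, ← Real.exp_add]
        refine Real.exp_le_exp.2 ?_
        have hmax : D + (P.L : ℝ) ^ K * ((HiggsLattice.Site.tdist (blockIter K x) b : ℝ) - 1) ≤ 2 * Db :=
          by rw [two_mul]; exact add_le_add (le_max_left _ _) (le_max_right _ _)
        have hK8 : (0 : ℝ) < 8 * K₀ * (P.L : ℝ) ^ K := by positivity
        have hK4 : (0 : ℝ) < 4 * K₀ * (P.L : ℝ) ^ K := by positivity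
        have key : (D + (P.L : ℝ) ^ K * ((HiggsLattice.Site.tdist (blockIter K x) b : ℝ) - 1) + 2 * (D₀ + D₁)) / (8 * K₀ * (P.L : ℝ) ^ K)
            ≤ (Db + D₀ + D₁) / (4 * K₀ * (P.L : ℝ) ^ K) :=
          calc (D + (P.L : ℝ) ^ K * ((HiggsLattice.Site.tdist (blockIter K x) b : ℝ) - 1) + 2 * (D₀ + D₁)) / (8 * K₀ * (P.L : ℝ) ^ K)
              ≤ (2 * Db + 2 * (D₀ + D₁)) / (8 * K₀ * (P.L : ℝ) ^ K) := div_le_div_of_nonneg_right (by linarith) hK8.le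
            _ = (Db + D₀ + D₁) / (4 * K₀ * (P.L : ℝ) ^ K) := by field_simp; ring
        have e1 : (D + (P.L : ℝ) ^ K * ((HiggsLattice.Site.tdist (blockIter K x) b : ℝ) - 1) + 2 * (D₀ + D₁)) / (8 * K₀ * (P.L : ℝ) ^ K)
            = (D + D₀ + D₁) / (8 * K₀ * (P.L : ℝ) ^ K) - 1 / (8 * K₀)
              + 1 / (8 * K₀) * (HiggsLattice.Site.tdist (blockIter K x) b : ℝ) + (D₀ + D₁) / (8 * K₀ * (P.L : ℝ) ^ K) := by
          field_simp
          ring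
        rw [e1] at key
        have hpos : 0 ≤ (D₀ + D₁) / (8 * K₀ * (P.L : ℝ) ^ K) := div_nonneg (by linarith) hK8.le
        linarith
      refine ⟨h.1.trans (mul_le_mul_of_nonneg_right (mul_le_mul_of_nonneg_left hkey (by positivity)) hM0),
        fun μ => (h.2 μ).trans (mul_le_mul_of_nonneg_right (mul_le_mul_of_nonneg_left hkey (by positivity)) hM0)⟩
    · -- no site maps to `b`: the piece vanishes
      have h0 : blockPiece K b g = 0 := by
        funext y
        unfold blockPiece
        rw [if_neg (fun h => hb ⟨y, h⟩)]
        rfl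
      have hwt0 : 0 ≤ wt b := by rw [hwt]; positivity
      rw [h0, smul_zero, smul_zero, map_zero, map_zero, sub_zero]
      refine ⟨?_, fun μ => ?_⟩
      · rw [Pi.zero_apply, norm_zero]; positivity
      · rw [covDeriv_zero', norm_zero]; positivity
  -- the sum of the weights
  have hsum := sum_exp_neg_tdist_le (P := P) (k := K) hrate (blockIter K x)
  have hwsum : ∑ b : HiggsLattice.Site P K, wt b
      ≤ Real.exp (-((D + D₀ + D₁) / (8 * K₀ * (P.L : ℝ) ^ K))) * Real.exp (1 / (8 * K₀)) * latticeConst P.d (1 / (8 * K₀)) := by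
    rw [hwt, ← Finset.mul_sum]
    exact mul_le_mul_of_nonneg_left hsum (by positivity)
  -- split `g` over the `K`-blocks
  have hsplit : propagatorK C Ω A msq a K (chi Ω • g) - propagatorK C Ω₀ A msq a K (chi Ω₀ • g)
      = ∑ b : HiggsLattice.Site P K,
          (propagatorK C Ω A msq a K (chi Ω • blockPiece K b g) - propagatorK C Ω₀ A msq a K (chi Ω₀ • blockPiece K b g)) := by
    conv_lhs => rw [← sum_blockPiece (K := K) g]
    rw [Finset.smul_sum, Finset.smul_sum, map_sum, map_sum, ← Finset.sum_sub_distrib]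
  refine ⟨?_, fun μ => ?_⟩
  · rw [hsplit, Finset.sum_apply]
    refine (norm_sum_le _ _).trans ?_
    refine (Finset.sum_le_sum fun b _ => (hpiece b).1).trans ?_
    rw [← Finset.sum_mul, ← Finset.mul_sum]
    calc c₀ * P.mesh K ^ 2 * (∑ b : HiggsLattice.Site P K, wt b) * M
        ≤ c₀ * P.mesh K ^ 2 * (Real.exp (-((D + D₀ + D₁) / (8 * K₀ * (P.L : ℝ) ^ K))) * Real.exp (1 / (8 * K₀))
            * latticeConst P.d (1 / (8 * K₀))) * M :=
          mul_le_mul_of_nonneg_right (mul_le_mul_of_nonneg_left hwsum (by positivity)) hM0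
      _ = c₀ * Real.exp (1 / (8 * K₀)) * latticeConst P.d (1 / (8 * K₀)) * P.mesh K ^ 2
            * Real.exp (-((D + D₀ + D₁) / (8 * K₀ * (P.L : ℝ) ^ K))) * M := by ring
  · rw [hsplit, covDeriv_sum']
    refine (norm_sum_le _ _).trans ?_
    refine (Finset.sum_le_sum fun b _ => (hpiece b).2 μ).trans ?_
    rw [← Finset.sum_mul, ← Finset.mul_sum]
    calc c₀ * P.mesh K * (∑ b : HiggsLattice.Site P K, wt b) * M
        ≤ c₀ * P.mesh K * (Real.exp (-((D + D₀ + D₁) / (8 * K₀ * (P.L : ℝ) ^ K))) * Real.exp (1 / (8 * K₀))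
            * latticeConst P.d (1 / (8 * K₀))) * M :=
          mul_le_mul_of_nonneg_right (mul_le_mul_of_nonneg_left hwsum (by positivity)) hM0
      _ = c₀ * Real.exp (1 / (8 * K₀)) * latticeConst P.d (1 / (8 * K₀)) * P.mesh K
            * Real.exp (-((D + D₀ + D₁) / (8 * K₀ * (P.L : ℝ) ^ K))) * M := by ring

end Literature.MathematicalPhysics.QuantumFieldTheory.Balaban1983to89.B1Ineq226RegularRegionSum

end
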